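import Literature.NumberTheory.LFunctions.ProlateExistsUnique
import HarnessLib

/-!
# Connes–Consani 2021, Lemma 5.4 numerics: truncation and shooting toolkit for the principal
# Frobenius solution at `λ = 1` (what a kernel certificate evaluates; PROVED, no numerics)

RH-FREE corpus literature (label, line 1): elementary series bookkeeping for
`u_b(x) = Σ_k a_k(b)(1 − x)^k` (`frobSol 1 b`); nothing in this file mentions `ζ`, the critical
strip or RH, and nothing here bears on the truth of RH.  bears_on (cell rh-crit, corpus C1): apex
input (B) — route «ConnesConsaniSemilocal» item K2 `DensitySlope` (stmt 19308), the (E-b)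
conjunct of `CC2021_section6_enclosures` (cc R70 tier 2: the kernel certificate for
`ε′(1⁺) ≈ 22.9965`).

Sources: A. Connes, C. Consani, *Weil positivity and trace formula, the archimedean place*, Selecta
Math. (N.S.) 27 (2021) 77 = arXiv:2006.13771 [bib `ConnesConsani2021`], Lemma 5.4 §5 pp. 32–33;
the Frobenius/shooting construction of the tree (`ProlateFrobenius.lean`,
`ProlateExistsUnique.lean`;
[Coddington–Levinson 1955, Ch. 4 §8, Ch. 8 §2], [Slepian–Pollak 1961, §III]).

## What is here (all PROVED, 0 definitions, 0 facts)

* `exists_critical_of_sign_change` / `…'` — a certified sign change of `b ↦ u_b′(0)` on `[b⁻, b⁺]`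
  yields a critical parameter `b` (`u_b′(0) = 0`) in the bracket (IVT, `continuous_frobSol₁_zero`);
* `summable_abs_frobCoeff_one`, `summable_succ_mul_abs_frobCoeff_one` — `Σ|a_k|`, `Σ(k+1)|a_{k+1}|`
  converge (radius `2 > 1`);
* `frobSol_one_zero_eq_tsum` (`u_b(0) = Σ a_k`), `frobSol₁_one_zero_eq_tsum`
  (`u_b′(0) = −Σ(k+1)a_{k+1}`);
* `abs_frobSol_sub_sum_le` — on `[0,1]`: `|u_b(x) − Σ_{k<K} a_k(1−x)^k| ≤ Σ_k |a_{k+K}|`;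
  `abs_frobSol₁_zero_add_sum_le` — `|u_b′(0) + Σ_{k<K}(k+1)a_{k+1}| ≤ Σ_k (k+K+1)|a_{k+K+1}|`.

WHAT THIS IS NOT: no tail constant `B·q^k` is derived here (that is the certificate's induction on
the four-term recursion `frobCoeff_rec`); no enclosure; nothing about `ζ` or RH.
-/

noncomputable section

open Real Set Filter Topology

namespace Literature.NumberTheory.LFunctions

/-! ## Shooting: a critical parameter from a certified sign change -/

/-- **IVT for the shooting function** `b ↦ u_b′(0)`: a sign change `u′(0; b⁻) ≤ 0 ≤ u′(0; b⁺)` on a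
bracket yields a critical parameter in the bracket.
[cite: CoddingtonLevinson1955, Ch. 8 §2 Thm 2.1; SlepianPollak1961, §III] -/
theorem exists_critical_of_sign_change {lo hi : ℝ} (h : lo ≤ hi)
    (hlo : frobSol₁ 1 lo 0 ≤ 0) (hhi : 0 ≤ frobSol₁ 1 hi 0) :
    ∃ b ∈ Icc lo hi, frobSol₁ 1 b 0 = 0 :=
  intermediate_value_Icc h (continuous_frobSol₁_zero one_pos).continuousOn ⟨hlo, hhi⟩

/-- IVT for the shooting function, opposite orientation: `u′(0; b⁺) ≤ 0 ≤ u′(0; b⁻)`.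
[cite: CoddingtonLevinson1955, Ch. 8 §2 Thm 2.1; SlepianPollak1961, §III] -/
theorem exists_critical_of_sign_change' {lo hi : ℝ} (h : lo ≤ hi)
    (hlo : 0 ≤ frobSol₁ 1 lo 0) (hhi : frobSol₁ 1 hi 0 ≤ 0) :
    ∃ b ∈ Icc lo hi, frobSol₁ 1 b 0 = 0 :=
  intermediate_value_Icc' h (continuous_frobSol₁_zero one_pos).continuousOn ⟨hhi, hlo⟩

/-! ## Summability and the values at `x = 0` -/

/-- `Σ_k |a_k(b)|` converges (radius of convergence `2λ = 2 > 1`).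
[cite: CoddingtonLevinson1955, Ch. 4 §8 (convergence proof)] -/
theorem summable_abs_frobCoeff_one (b : ℝ) : Summable (fun k ↦ |frobCoeff 1 b k|) := by
  refine summable_of_le_frobCoeff one_pos b (t := 1) (by norm_num) 0 0 (K := 1) fun k ↦ ?_
  simp [abs_abs]

/-- `Σ_k |a_{k+K}(b)|` converges, every shift `K`. [cite: CoddingtonLevinson1955, Ch. 4 §8] -/
theorem summable_abs_frobCoeff_one_add (b : ℝ) (K : ℕ) :
    Summable (fun k ↦ |frobCoeff 1 b (k + K)|) :=
  (summable_nat_add_iff (f := fun k ↦ |frobCoeff 1 b k|) K).mpr (summable_abs_frobCoeff_one b)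

/-- `Σ_k (k+1)|a_{k+1}(b)|` converges. [cite: CoddingtonLevinson1955, Ch. 4 §8] -/
theorem summable_succ_mul_abs_frobCoeff_one (b : ℝ) :
    Summable (fun k : ℕ ↦ ((k : ℝ) + 1) * |frobCoeff 1 b (k + 1)|) := by
  refine summable_of_le_frobCoeff one_pos b (t := 1) (by norm_num) 1 1 (K := 1) fun k ↦ ?_
  have h0 : (0 : ℝ) ≤ (k : ℝ) + 1 := by positivity
  rw [abs_mul, abs_abs, abs_of_nonneg h0]
  simp

/-- **`u_b(0) = Σ_k a_k(b)`**. [cite: CoddingtonLevinson1955, Ch. 4 §8] -/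
theorem frobSol_one_zero_eq_tsum (b : ℝ) : frobSol 1 b 0 = ∑' k, frobCoeff 1 b k := by
  simp [frobSol]

/-- **`u_b′(0) = −Σ_k (k+1) a_{k+1}(b)`**. [cite: CoddingtonLevinson1955, Ch. 4 §8] -/
theorem frobSol₁_one_zero_eq_tsum (b : ℝ) :
    frobSol₁ 1 b 0 = -∑' k : ℕ, ((k : ℝ) + 1) * frobCoeff 1 b (k + 1) := by
  simp [frobSol₁]

/-! ## Truncation bounds on `[0, 1]` -/

/-- `|Σ' f| ≤ Σ' |f|` for an absolutely summable real sequence. [folklore] -/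
private theorem abs_tsum_le {f : ℕ → ℝ} (hf : Summable (fun i ↦ |f i|)) :
    |∑' i, f i| ≤ ∑' i, |f i| := by
  have h := norm_tsum_le_tsum_norm (f := f) (by simpa [Real.norm_eq_abs] using hf)
  simpa [Real.norm_eq_abs] using h

/-- **Truncation of `u_b` on `[0,1]`**: `|u_b(x) − Σ_{k<K} a_k(1−x)^k| ≤ Σ_k |a_{k+K}|`
(`0 ≤ 1 − x ≤ 1`). [cite: CoddingtonLevinson1955, Ch. 4 §8] -/
theorem abs_frobSol_sub_sum_le (b : ℝ) {x : ℝ} (hx : x ∈ Icc (0 : ℝ) 1) (K : ℕ) :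
    |frobSol 1 b x - ∑ k ∈ Finset.range K, frobCoeff 1 b k * (1 - x) ^ k|
      ≤ ∑' k, |frobCoeff 1 b (k + K)| := by
  have ht0 : 0 ≤ 1 - x := by linarith [hx.2]
  have ht1 : 1 - x ≤ 1 := by linarith [hx.1]
  have hpow : ∀ k : ℕ, |(1 - x) ^ k| ≤ 1 := fun k ↦ by
    rw [abs_pow, abs_of_nonneg ht0]; exact pow_le_one₀ ht0 ht1
  have hs : Summable (fun k ↦ frobCoeff 1 b k * (1 - x) ^ k) := by
    refine Summable.of_norm_bounded (summable_abs_frobCoeff_one b) fun k ↦ ?_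
    rw [Real.norm_eq_abs, abs_mul]
    exact mul_le_of_le_one_right (abs_nonneg _) (hpow k)
  rw [frobSol, ← hs.sum_add_tsum_nat_add K, add_sub_cancel_left]
  have hsK : Summable (fun k ↦ |frobCoeff 1 b (k + K) * (1 - x) ^ (k + K)|) :=
    ((summable_nat_add_iff (f := fun k ↦ frobCoeff 1 b k * (1 - x) ^ k) K).mpr hs).abs
  refine (abs_tsum_le hsK).trans ?_
  refine hsK.tsum_le_tsum (fun k ↦ ?_) (summable_abs_frobCoeff_one_add b K)
  rw [abs_mul]
  exact mul_le_of_le_one_right (abs_nonneg _) (hpow _)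

/-- **Truncation of the shooting value**:
`|u_b′(0) + Σ_{k<K}(k+1)a_{k+1}| ≤ Σ_k (k+K+1)|a_{k+K+1}|`.
[cite: CoddingtonLevinson1955, Ch. 4 §8; Ch. 8 §2] -/
theorem abs_frobSol₁_zero_add_sum_le (b : ℝ) (K : ℕ) :
    |frobSol₁ 1 b 0 + ∑ k ∈ Finset.range K, ((k : ℝ) + 1) * frobCoeff 1 b (k + 1)|
      ≤ ∑' k : ℕ, (((k + K : ℕ) : ℝ) + 1) * |frobCoeff 1 b (k + K + 1)| := by
  have hs : Summable (fun k : ℕ ↦ ((k : ℝ) + 1) * frobCoeff 1 b (k + 1)) := by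
    refine Summable.of_norm_bounded (summable_succ_mul_abs_frobCoeff_one b) fun k ↦ ?_
    rw [Real.norm_eq_abs, abs_mul, abs_of_nonneg (by positivity : (0 : ℝ) ≤ (k : ℝ) + 1)]
  have key : frobSol₁ 1 b 0 + ∑ k ∈ Finset.range K, ((k : ℝ) + 1) * frobCoeff 1 b (k + 1)
      = -∑' k : ℕ, (((k + K : ℕ) : ℝ) + 1) * frobCoeff 1 b (k + K + 1) := by
    rw [frobSol₁_one_zero_eq_tsum, ← hs.sum_add_tsum_nat_add K]
    ring
  have hsK : Summable (fun k : ℕ ↦ |(((k + K : ℕ) : ℝ) + 1) * frobCoeff 1 b (k + K + 1)|) :=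
    ((summable_nat_add_iff
      (f := fun k : ℕ ↦ ((k : ℝ) + 1) * frobCoeff 1 b (k + 1)) K).mpr hs).abs
  rw [key, abs_neg]
  refine (abs_tsum_le hsK).trans (le_of_eq (tsum_congr fun k ↦ ?_))
  rw [abs_mul, abs_of_nonneg (by positivity : (0 : ℝ) ≤ ((k + K : ℕ) : ℝ) + 1)]

end Literature.NumberTheory.LFunctions

end
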